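import Summits.ABC.ABC.Theses.YuMatveevShapeRat
import Summits.ABC.ABC.Theorems.YuMatveevShapeRatPadicCoreTwoRatCount
import Summits.ABC.ABC.Theorems.YuMatveevShapeRatPadicCoreTwoRatLines
import Summits.ABC.StewartYu.PadicG3TwoFrameSatDet
import Literature.NumberTheory.Transcendental.Nesterenko2003Prop51Holds
import HarnessLib

/-!
# Crux `PadicCoreTwoRat` (stmt-ABC-20504) of route `YuMatveevShapeRat` — CLOSED (line `padic-two-sat-frame`)

The KUMMER-FREE `2`-adic core over `ℚ` in shape form — for `θᵢ ≡ 1 (mod 8)`, multiplicatively independent, `h(θᵢ) ≤ Aᵢ`, `1 ≤ Aᵢ ≤ Amax`,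
`log max(3,|mᵢ|) ≤ W`, `1 ≤ W`: `ord₂(∏ θᵢ^{mᵢ} − 1) ≤ cʳ·(∏ Aᵢ)·(W + log(2·Amax))` with `c = 2^113` — as a sorry-free consequence of the
cell's 𝔑-threaded (saturated-basis) Gen-3 `2`-adic frame (cell abc-stewartyu, HOME `run/shared/lean/pub/abc-stewartyu/`; WP-L.P(2) lead p3
g9 → g10, with lp-1 (saturated interfaces, smallness), p5 (END block pattern), p1 (ledger `PadicG3Par`, Siegel count), p4 (record exits)):

* the pivot-last saturated presentation of every datum `TwoSetup.satKitFullDet_holds` and the frame from a record supply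
  `TwoSetup.frameTwoRat_of_recordSatDet` (`PadicG3TwoFrameSatDet`);
* the record supply at the PADDED letter `W̃ = W + c_W(d)`, `c_W(d) = (2d+5)(d+1)`, from the three supplies
  `TwoSetup.recordSupplyTwoSatDet_of_suppliesW` (`PadicG3TwoSatSupplyW`; smallness by lp-1's `smallPackTwoN_of_gain`, record `RecordTwo` at
  the crux letter by `ParTwo.recordTwo_parTwo_W`): COUNT ✓ `stub_countTwoNW` (`…PadicCoreTwoRatCount`), LINES ✓ `stub_linesTwoNW`
  (`…PadicCoreTwoRatLines`: budgets `PadicG3TwoBudgetZN/ZBN/KN/TN` over the schedule of record `schedTwoN` of `PadicG3TwoSchedSatN` and its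
  pack `PadicG3TwoSatPack`), END ✓ `TwoSetup.endSupplyTwoNW_of`;
* the Matveev/rank shell `GenThreeBaseTwoRat.padicCoreTwoRat_of_frame_two_le` at the shared zero estimate `Nesterenko2003_prop51_holds`.

The constant function of record is `C m = 2^{113 m}` (`2^{111(d+1)}·(1 + c_W(d)) ≤ 2^{113(d+1)}`, `≥ 256^{n−r}·C r`, `C 1 ≥ 4`).
-/

noncomputable section

-- `Summit.<Summit>.<Problem>` is the mandated summit-side namespace (CONVENTIONS §2); for the single-conjunct summit `ABC` the two
-- coincide, so the duplicate `ABC.ABC` is deliberate.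
set_option linter.dupNamespace false

namespace Summit.ABC.ABC.Theorems

open Summit.ABC.StewartYu Summit.ABC.StewartYu.GenThreeFrameSpecTwoRat
open Literature.NumberTheory.Transcendental Literature.NumberTheory.Transcendental.GaGm

/-- `0 ≤ 2^{113 r} ≤ (2^113)^r`. [folklore] -/
theorem cLineTwo_bounds : ∀ r : ℕ, 0 ≤ (2 : ℝ) ^ (113 * r) ∧ (2 : ℝ) ^ (113 * r) ≤ ((2 : ℝ) ^ 113) ^ r :=
  fun r => ⟨by positivity, by rw [← pow_mul]⟩

/-- `4 ≤ 2^{113·1}`. [folklore] -/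
theorem four_le_cLineTwo_one : (4 : ℝ) ≤ (2 : ℝ) ^ (113 * 1) := by norm_num

/-- `256^{n−r}·2^{113 r} ≤ 2^{113 n}` for `r < n`. [folklore] -/
theorem cLineTwo_growth : ∀ n r : ℕ, r < n → (256 : ℝ) ^ (n - r) * (2 : ℝ) ^ (113 * r) ≤ (2 : ℝ) ^ (113 * n) := by
  intro n r hr
  have e : (256 : ℝ) = 2 ^ 8 := by norm_num
  rw [e, ← pow_mul, ← pow_add]
  exact pow_le_pow_right₀ (by norm_num) (by omega)

/-- The padding fits the constant: `2^{111(d+1)}·(1 + c_W d) ≤ 2^{113(d+1)}` for `d ≥ 1` (`1 + c_W d ≤ 4^{d+1}`). [folklore] -/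
theorem cLineTwo_pad : ∀ d : ℕ, 1 ≤ d → (2 : ℝ) ^ (111 * (d + 1)) * (1 + (TwoSetup.cW d : ℝ)) ≤ (2 : ℝ) ^ (113 * (d + 1)) := by
  intro d hd
  have h := TwoSetup.one_add_cW_le_four_pow hd
  have h' : (1 : ℝ) + (TwoSetup.cW d : ℝ) ≤ (4 : ℝ) ^ (d + 1) := by exact_mod_cast h
  rw [show (4 : ℝ) = 2 ^ 2 by norm_num, ← pow_mul] at h'
  calc (2 : ℝ) ^ (111 * (d + 1)) * (1 + (TwoSetup.cW d : ℝ)) ≤ (2 : ℝ) ^ (111 * (d + 1)) * (2 : ℝ) ^ (2 * (d + 1)) :=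
        mul_le_mul_of_nonneg_left h' (by positivity)
    _ = (2 : ℝ) ^ (113 * (d + 1)) := by rw [← pow_add]; congr 1; ring

/-- **The END supply at the padded letter for `C m = 2^{113 m}`**, by ✓ `TwoSetup.endSupplyTwoNW_of`. [cite: Nesterenko2003, §5.2; shape only] -/
theorem endTwoNW_cLineTwo : TwoSetup.EndSupplyTwoNW (fun m => (2 : ℝ) ^ (113 * m)) :=
  TwoSetup.endSupplyTwoNW_of (fun r => (cLineTwo_bounds r).1) cLineTwo_growth

/-- **The record supply (index identity available) for `C m = 2^{113 m}` at every rank `d + 1 ≥ 2`**: count ✓, lines ✓, END ✓ through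
✓ `TwoSetup.recordSupplyTwoSatDet_of_suppliesW`. [cite: Nesterenko2003, Thm 2.7 (K = ℚ, p = 2, θ-twisted); shape only] -/
theorem recordSupplyTwoSatDet_cLineTwo : ∀ d : ℕ, 1 ≤ d → TwoSetup.RecordSupplyTwoSatDet (fun m => (2 : ℝ) ^ (113 * m)) d :=
  fun _ hd => TwoSetup.recordSupplyTwoSatDet_of_suppliesW cLineTwo_pad stub_countTwoNW stub_linesTwoNW endTwoNW_cLineTwo hd

/-- **The Kummer-free `2`-adic frame at every rank `n ≥ 2`** for `C m = 2^{113 m}`: saturated kit ✓ + record supply ✓ through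
✓ `TwoSetup.frameTwoRat_of_recordSatDet`. [cite: Yu2007, Main Thm (K = ℚ, ℘ = 2); shape only] -/
theorem frameTwoRat_cLineTwo : ∀ n : ℕ, 2 ≤ n → FrameTwoRat (fun m => (2 : ℝ) ^ (113 * m)) n := by
  intro n hn
  obtain ⟨d, rfl⟩ : ∃ d, n = d + 1 := ⟨n - 1, by omega⟩
  exact TwoSetup.frameTwoRat_of_recordSatDet (satKitFullDet_holds (d + 1)) (recordSupplyTwoSatDet_cLineTwo d (by omega))

/-- **CRUX `PadicCoreTwoRat` OF ROUTE `YuMatveevShapeRat`** — the Kummer-free `2`-adic core over `ℚ` in shape form with `c = 2^113`, in the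
kernel: frame (`frameTwoRat_cLineTwo`) → rank shell `GenThreeBaseTwoRat.padicCoreTwoRat_of_frame_two_le` at the zero estimate
`Nesterenko2003_prop51_holds`. [cite: Yu2007, Main Thm (K = ℚ, ℘ = 2)] -/
theorem PadicCoreTwoRat_proof : Summit.ABC.ABC.Theses.YuMatveevShapeRat.PadicCoreTwoRat :=
  GenThreeBaseTwoRat.padicCoreTwoRat_of_frame_two_le (C := fun m => (2 : ℝ) ^ (113 * m)) (c₁ := (2 : ℝ) ^ 113)
    cLineTwo_bounds four_le_cLineTwo_one (fun _ => frameTwoRat_cLineTwo) Nesterenko2003_prop51_holds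

end Summit.ABC.ABC.Theorems

end
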